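import Mathlib
import Summits.NavierStokesRegularity.NavierStokesRegularity.Theorems.EulerZoomLiouvillePowerGaugeEulerLiouvilleNeedleFastTime
import Summits.NavierStokesRegularity.NavierStokesRegularity.Theorems.EulerZoomLiouvillePowerGaugeEulerLiouvilleNeedleStretchingVisit
import Summits.NavierStokesRegularity.NavierStokesRegularity.Theorems.EulerZoomLiouvillePowerGaugeEulerLiouvilleSelfSimilarCountableNodalSet

/-!
# LASALLE FOR LINGERING CUT-OFF ORBITS: eternal lingerers come to rest at ONE node (ROUND-41 THEOREM A chain, file 2;
# nsreg-p2 R41 §1 (E1)/(E2))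

Width piece for crux `EulerZoomLiouville.PowerGaugeEulerLiouville` (stmt-NavierStokesRegularity-19832), by name under
LEAD 19832 (ns-typeII-p2); seat ns-ezl-w2 g4 (lane T5, α-limit assemblies), `--supports … --as helper`.

Setting of THE ONE STATEMENT's clock predicates: `(U, P)` a self-similar Euler profile (`γ < ½`), `V` a `C¹`/`C²` cut-off copy
with `‖DV‖ ≤ K` and `V = U` on `ball 0 R_big ⊃ B̄(0, M)`, backward similarity flow `Ψ_σ y = Φ_{−σ} y` of `W_V = γy + V`
(`Literature.Analysis.ODE.evolutionMap`).  An ETERNAL LINGERER is a label `y` with `‖Ψ_σ y‖ ≤ M` for all `σ ≥ 0`.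

* `tendsto_transport_comp_of_bounded_Ici` — the HALF-LINE form of the Literature LaSalle/Barbalat theorem
  `IsSelfSimilarEulerProfile.tendsto_transport_comp_of_bounded` (CIV (3.31): `ℋ` is a Lyapunov function): a continuous curve
  solving `Y′ = σ·W_U(Y)` for `t ≥ 0` only and staying in `B̄(0, B)` has `W_U(Y t) → 0` (`γ ≠ ½`);
* **`tendsto_transport_flow_of_linger`** — (E1) for the cut-off flow: along an eternal lingerer `W_U(Ψ_σ y) → 0`;
* **`exists_tendsto_flow_of_linger_of_countable`** — if the stagnation set of `W_U` in `B̄(0, M)` is COUNTABLE, every eternal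
  lingerer CONVERGES to one node `z ∈ B̄(0, M)`, `W_U z = 0` (compactness gives a cluster point; the tree's
  `NodalFiniteness.tendsto_of_transport_comp_tendsto_zero_of_countable` applied to `Ṽ = (‖W_U‖ + infDist(·, B̄_M))·e₀`);
* `curl_flow_ne_zero_of_linger` — (E2) vortical labels stay vortical along lingering orbits ((T1′) with the constant
  majorant `sup_{B̄_M}‖DU‖`);
* `flow_neg_add_of_linger` — re-basing `Ψ_{τ+σ₀} y = Ψ_τ(Ψ_{σ₀} y)` (group law, `C2.Kelvin.flow_add`).

HONEST FRAMING: dynamics of the backward similarity flow of HYPOTHETICAL self-similar Euler profiles (MODEL lattice of the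
crux class); proves nothing about the crux E (19832 OPEN), any door Target, or Navier–Stokes regularity.
[folklore; cf. ConstantinIgnatovaVicol2026Putative §3.4.3 (3.31)–(3.33), Rem. 3.6]
-/

noncomputable section

open Set Filter Topology Metric Function MeasureTheory intervalIntegral
open scoped RealInnerProductSpace NNReal ENNReal

set_option linter.dupNamespace false

namespace Summit.NavierStokesRegularity.NavierStokesRegularity.Theorems.PowerGaugeEulerLiouville.NeedleClock

open Literature.Analysis Literature.Analysis.FluidPDE
open Summit.NavierStokesRegularity.NavierStokesRegularity.Theorems.PowerGaugeEulerLiouville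

variable {γ : ℝ} {U V : EuclideanSpace ℝ (Fin 3) → EuclideanSpace ℝ (Fin 3)} {P : EuclideanSpace ℝ (Fin 3) → ℝ}

/-! ### Barbalat on a half-line -/

/-- **Trapped HALF-trajectories come to rest (`γ ≠ ½`).**  `(U, P)` a self-similar Euler profile, `Y` a continuous curve
with `Y′(t) = σ·W_U(Y t)` for every `t ≥ 0` (`σ ≠ 0`; `σ = −1`: backward orbits) and `‖Y t‖ ≤ B` for `t ≥ 0`.  Then
`W_U(Y t) → 0` as `t → ∞`.  (The Literature theorem `IsSelfSimilarEulerProfile.tendsto_transport_comp_of_bounded` asks the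
ODE for all `t ∈ ℝ`; its Barbalat proof — `ℋ(Y b) − ℋ(Y a) = σ(2γ−1)∫_a^b‖W_U(Y)‖²`, Lipschitz speed — only uses `t ≥ 0`
and is repeated here with `bernoulli_comp_sub_eq_of_Icc`.) [cite: ConstantinIgnatovaVicol2026Putative, §3.4.3 eq. (3.31)–(3.33) and Rem. 3.6] -/
theorem tendsto_transport_comp_of_bounded_Ici {c : EuclideanSpace ℝ (Fin 3)} (h : IsSelfSimilarEulerProfile γ c U P)
    (hγ : γ ≠ 1 / 2) {σ : ℝ} (hσ : σ ≠ 0) {Y : ℝ → EuclideanSpace ℝ (Fin 3)} (hYc : Continuous Y)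
    (hY : ∀ t, 0 ≤ t → HasDerivAt Y (σ • selfSimilarTransport γ c U (Y t)) t) {B : ℝ}
    (hB : ∀ t, 0 ≤ t → ‖Y t‖ ≤ B) :
    Tendsto (fun t => selfSimilarTransport γ c U (Y t)) atTop (𝓝 0) := by
  have hVc : Continuous (selfSimilarTransport γ c U) := by
    have e : selfSimilarTransport γ c U = fun y => γ • (y - c) + U y := rfl
    rw [e]; exact ((continuous_id.sub continuous_const).const_smul γ).add h.contDiff_velocity.continuous
  set g : ℝ → ℝ := fun t => ‖selfSimilarTransport γ c U (Y t)‖ with hg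
  have hgc : Continuous g := (hVc.comp hYc).norm
  -- bounds on the ball: speed `S`, Lipschitz constant `L` of `U`, `|ℋ| ≤ Mb`
  obtain ⟨S, hS⟩ := (isCompact_closedBall (0 : EuclideanSpace ℝ (Fin 3)) B).exists_bound_of_continuousOn
    hVc.continuousOn
  obtain ⟨L, hL⟩ := (isCompact_closedBall (0 : EuclideanSpace ℝ (Fin 3)) B).exists_bound_of_continuousOn
    ((h.contDiff_velocity.continuous_fderiv (by norm_num)).continuousOn)
  obtain ⟨Mb, hMb⟩ := (isCompact_closedBall (0 : EuclideanSpace ℝ (Fin 3)) B).exists_bound_of_continuousOn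
    h.contDiff_selfSimilarBernoulli.continuous.continuousOn
  have hS0 : 0 ≤ S := (norm_nonneg _).trans (hS (Y 0) (mem_closedBall_zero_iff.2 (hB 0 le_rfl)))
  have hL0 : 0 ≤ L := (norm_nonneg _).trans (hL (Y 0) (mem_closedBall_zero_iff.2 (hB 0 le_rfl)))
  -- `Y` is `|σ| S`-Lipschitz on `[0, ∞)`
  have hYlip : ∀ s t : ℝ, 0 ≤ s → s ≤ t → ‖Y t - Y s‖ ≤ |σ| * S * (t - s) := by
    intro s t hs hst
    have key := Convex.norm_image_sub_le_of_norm_hasDerivWithin_le (f := Y) (s := Ici (0 : ℝ))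
      (C := |σ| * S) (fun x hx => (hY x hx).hasDerivWithinAt) (fun x hx => ?_) (convex_Ici 0) (mem_Ici.2 hs)
      (mem_Ici.2 (hs.trans hst))
    · rw [Real.norm_eq_abs, abs_of_nonneg (sub_nonneg.2 hst)] at key
      exact key
    · rw [norm_smul, Real.norm_eq_abs]
      exact mul_le_mul_of_nonneg_left (hS _ (mem_closedBall_zero_iff.2 (hB x hx))) (abs_nonneg _)
  -- `W_U` is `(|γ| + L)`-Lipschitz on the ball
  have hVlip : ∀ x y : EuclideanSpace ℝ (Fin 3), ‖x‖ ≤ B → ‖y‖ ≤ B →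
      ‖selfSimilarTransport γ c U y - selfSimilarTransport γ c U x‖ ≤ (|γ| + L) * ‖y - x‖ := by
    intro x y hx hy
    have hU : ‖U y - U x‖ ≤ L * ‖y - x‖ :=
      Convex.norm_image_sub_le_of_norm_fderiv_le (fun z _ => h.differentiable_velocity z)
        (fun z hz => hL z hz) (convex_closedBall 0 B) (mem_closedBall_zero_iff.2 hx)
        (mem_closedBall_zero_iff.2 hy)
    have e : selfSimilarTransport γ c U y - selfSimilarTransport γ c U x = γ • (y - x) + (U y - U x) := by
      simp only [selfSimilarTransport_apply, smul_sub]
      abel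
    rw [e]
    calc ‖γ • (y - x) + (U y - U x)‖ ≤ ‖γ • (y - x)‖ + ‖U y - U x‖ := norm_add_le _ _
      _ ≤ |γ| * ‖y - x‖ + L * ‖y - x‖ := by
          rw [norm_smul, Real.norm_eq_abs]
          exact add_le_add le_rfl hU
      _ = (|γ| + L) * ‖y - x‖ := by ring
  set Λ : ℝ := (|γ| + L) * (|σ| * S) with hΛ
  have hΛ0 : 0 ≤ Λ := by positivity
  have hglip : ∀ s t : ℝ, 0 ≤ s → s ≤ t → |g t - g s| ≤ Λ * (t - s) := by
    intro s t hs hst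
    calc |g t - g s| ≤ ‖selfSimilarTransport γ c U (Y t) - selfSimilarTransport γ c U (Y s)‖ :=
          abs_norm_sub_norm_le _ _
      _ ≤ (|γ| + L) * ‖Y t - Y s‖ := hVlip _ _ (hB s hs) (hB t (hs.trans hst))
      _ ≤ (|γ| + L) * (|σ| * S * (t - s)) := mul_le_mul_of_nonneg_left (hYlip s t hs hst) (by positivity)
      _ = Λ * (t - s) := by rw [hΛ]; ring
  -- the action budget on `[a, b] ⊂ [0, ∞)`
  have hκ : σ * (2 * γ - 1) ≠ 0 := mul_ne_zero hσ (by intro h0; apply hγ; linarith)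
  obtain ⟨C, hC⟩ : ∃ C : ℝ, ∀ a b : ℝ, 0 ≤ a → a ≤ b →
      ∫ t in a..b, ‖selfSimilarTransport γ c U (Y t)‖ ^ 2 ≤ C := by
    refine ⟨2 * Mb / |σ * (2 * γ - 1)|, fun a b ha hab => ?_⟩
    have e := bernoulli_comp_sub_eq_of_Icc h hab (fun t ht => hY t (ha.trans ht.1))
    have hMa : ‖selfSimilarBernoulli γ c U P (Y a)‖ ≤ Mb := hMb _ (mem_closedBall_zero_iff.2 (hB a ha))
    have hMb' : ‖selfSimilarBernoulli γ c U P (Y b)‖ ≤ Mb :=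
      hMb _ (mem_closedBall_zero_iff.2 (hB b (ha.trans hab)))
    have h1 : |σ * (2 * γ - 1) * ∫ t in a..b, ‖selfSimilarTransport γ c U (Y t)‖ ^ 2| ≤ 2 * Mb := by
      rw [← e]
      rw [Real.norm_eq_abs] at hMa hMb'
      calc |selfSimilarBernoulli γ c U P (Y b) - selfSimilarBernoulli γ c U P (Y a)|
          ≤ |selfSimilarBernoulli γ c U P (Y b)| + |selfSimilarBernoulli γ c U P (Y a)| := abs_sub _ _
        _ ≤ Mb + Mb := add_le_add hMb' hMa
        _ = 2 * Mb := by ring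
    rw [abs_mul] at h1
    have hpos : 0 < |σ * (2 * γ - 1)| := abs_pos.2 hκ
    rw [le_div_iff₀ hpos]
    calc (∫ t in a..b, ‖selfSimilarTransport γ c U (Y t)‖ ^ 2) * |σ * (2 * γ - 1)|
        ≤ |∫ t in a..b, ‖selfSimilarTransport γ c U (Y t)‖ ^ 2| * |σ * (2 * γ - 1)| :=
          mul_le_mul_of_nonneg_right (le_abs_self _) hpos.le
      _ = |σ * (2 * γ - 1)| * |∫ t in a..b, ‖selfSimilarTransport γ c U (Y t)‖ ^ 2| := mul_comm _ _
      _ ≤ 2 * Mb := h1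
  -- the speed-square integral `I(T) = ∫_0^T g²` is nondecreasing and bounded, hence Cauchy
  set I : ℝ → ℝ := fun T => ∫ t in (0 : ℝ)..T, g t ^ 2 with hI
  have hgi : ∀ a b : ℝ, IntervalIntegrable (fun t => g t ^ 2) volume a b :=
    fun a b => (hgc.pow 2).intervalIntegrable a b
  have hImono : Monotone fun T : ℝ => I (max T 0) := by
    intro T₁ T₂ h12
    have hm : max T₁ 0 ≤ max T₂ 0 := max_le_max h12 le_rfl
    show I (max T₁ 0) ≤ I (max T₂ 0)
    rw [hI]
    simp only
    rw [← intervalIntegral.integral_add_adjacent_intervals (hgi 0 (max T₁ 0)) (hgi (max T₁ 0) (max T₂ 0))]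
    have : 0 ≤ ∫ t in max T₁ 0..max T₂ 0, g t ^ 2 :=
      intervalIntegral.integral_nonneg hm fun t _ => sq_nonneg _
    linarith
  have hIbdd : BddAbove (range fun T : ℝ => I (max T 0)) := by
    refine ⟨C, ?_⟩
    rintro _ ⟨T, rfl⟩
    exact hC 0 (max T 0) le_rfl (le_max_right _ _)
  have hIlim : Tendsto (fun T : ℝ => I (max T 0)) atTop (𝓝 (⨆ T : ℝ, I (max T 0))) :=
    tendsto_atTop_ciSup hImono hIbdd
  -- Barbalat: `g → 0`
  rw [tendsto_zero_iff_norm_tendsto_zero]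
  change Tendsto g atTop (𝓝 0)
  rw [Metric.tendsto_atTop]
  intro ε hε
  by_contra hcon
  push Not at hcon
  obtain ⟨δ, hδ0, hδ⟩ : ∃ δ : ℝ, 0 < δ ∧ Λ * δ ≤ ε / 2 := by
    by_cases hΛz : Λ = 0
    · exact ⟨1, one_pos, by rw [hΛz, zero_mul]; linarith⟩
    · have hΛp : 0 < Λ := lt_of_le_of_ne hΛ0 (Ne.symm hΛz)
      refine ⟨ε / 2 / Λ, by positivity, ?_⟩
      rw [mul_div_cancel₀ _ hΛz]
  have hη : 0 < δ * (ε / 2) ^ 2 := by positivity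
  have hcau := (Metric.tendsto_atTop.1 hIlim) (δ * (ε / 2) ^ 2 / 2) (by positivity)
  obtain ⟨N, hN⟩ := hcau
  obtain ⟨t, htN, hgt⟩ := hcon (max N 0)
  have ht0 : 0 ≤ t := (le_max_right _ _).trans htN
  have htN' : N ≤ t := (le_max_left _ _).trans htN
  have hge : ∀ s ∈ Icc t (t + δ), ε / 2 ≤ g s := by
    intro s hs
    have h1 := hglip t s ht0 hs.1
    have h2 : Λ * (s - t) ≤ ε / 2 := (mul_le_mul_of_nonneg_left (by linarith [hs.2]) hΛ0).trans hδ
    have h3 : dist (g t) 0 = g t := by rw [dist_zero_right, Real.norm_eq_abs, abs_of_nonneg (norm_nonneg _)]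
    have hgt' : ε ≤ g t := by rw [← h3]; exact hgt
    have h4 : g t - g s ≤ ε / 2 := ((le_abs_self _).trans (by rw [abs_sub_comm]; exact h1)).trans h2
    linarith
  have hlow : δ * (ε / 2) ^ 2 ≤ I (t + δ) - I t := by
    have e : I (t + δ) - I t = ∫ s in t..t + δ, g s ^ 2 := by
      rw [hI]
      simp only
      rw [← intervalIntegral.integral_add_adjacent_intervals (hgi 0 t) (hgi t (t + δ))]
      ring
    rw [e]
    have h1 : ∫ s in t..t + δ, (ε / 2) ^ 2 ≤ ∫ s in t..t + δ, g s ^ 2 :=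
      intervalIntegral.integral_mono_on (by linarith) (intervalIntegrable_const) (hgi t (t + δ))
        fun s hs => pow_le_pow_left₀ (by positivity) (hge s hs) 2
    rw [intervalIntegral.integral_const, smul_eq_mul] at h1
    linarith
  have hIt : dist (I (max t 0)) (⨆ T : ℝ, I (max T 0)) < δ * (ε / 2) ^ 2 / 2 := hN t htN'
  have hItδ : dist (I (max (t + δ) 0)) (⨆ T : ℝ, I (max T 0)) < δ * (ε / 2) ^ 2 / 2 :=
    hN (t + δ) (by linarith)
  rw [max_eq_left ht0] at hIt
  rw [max_eq_left (by linarith : (0 : ℝ) ≤ t + δ)] at hItδ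
  have := dist_triangle_right (I (t + δ)) (I t) (⨆ T : ℝ, I (max T 0))
  rw [Real.dist_eq, abs_of_nonneg (by linarith : 0 ≤ I (t + δ) - I t)] at this
  linarith

/-! ### (E1) for lingering cut-off orbits -/

/-- **(E1) ETERNAL LINGERERS COME TO REST.**  `V ∈ C¹` with `‖DV‖ ≤ K`, `V = U` on `ball 0 R_big`, `M < R_big`, `γ < ½`;
if `‖Ψ_σ y‖ ≤ M` for all `σ ≥ 0` then `W_U(Ψ_σ y) → 0` as `σ → ∞` (inside the ball the cut-off backward flow IS the profile's
backward similarity flow, so `tendsto_transport_comp_of_bounded_Ici` applies).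
[cite: ConstantinIgnatovaVicol2026Putative, §3.4.3 eq. (3.33) and Rem. 3.6] -/
theorem tendsto_transport_flow_of_linger (hprof : IsSelfSimilarEulerProfile γ 0 U P) (hγ2 : γ < 1 / 2)
    (hV : ContDiff ℝ 1 V) {K : ℝ} (hK : ∀ y, ‖fderiv ℝ V y‖ ≤ K) {M Rbig : ℝ} (hMR : M < Rbig)
    (hVU : ∀ w ∈ ball (0 : EuclideanSpace ℝ (Fin 3)) Rbig, V w = U w) {y : EuclideanSpace ℝ (Fin 3)}
    (hy : ∀ σ, 0 ≤ σ → ‖ODE.evolutionMap (fun _ : ℝ => selfSimilarTransport γ 0 V) 0 (-σ) y‖ ≤ M) :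
    Tendsto (fun σ => selfSimilarTransport γ 0 U
      (ODE.evolutionMap (fun _ : ℝ => selfSimilarTransport γ 0 V) 0 (-σ) y)) atTop (𝓝 0) := by
  set Z : ℝ → EuclideanSpace ℝ (Fin 3) :=
    fun σ => ODE.evolutionMap (fun _ : ℝ => selfSimilarTransport γ 0 V) 0 (-σ) y with hZ
  have hZc : Continuous Z := continuous_flow_neg_apply (γ := γ) hV hK y
  have hWeq : ∀ σ, 0 ≤ σ → selfSimilarTransport γ 0 V (Z σ) = selfSimilarTransport γ 0 U (Z σ) := by
    intro σ hσ
    have hmem : Z σ ∈ ball (0 : EuclideanSpace ℝ (Fin 3)) Rbig :=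
      mem_ball_zero_iff.2 (lt_of_le_of_lt (hy σ hσ) hMR)
    simp only [selfSimilarTransport_apply, hVU _ hmem]
  have hder : ∀ σ, 0 ≤ σ → HasDerivAt Z ((-1 : ℝ) • selfSimilarTransport γ 0 U (Z σ)) σ := by
    intro σ hσ
    have h1 := C2.Kelvin.hasDerivAt_flow_neg (γ := γ) hV hK y σ
    rw [hWeq σ hσ] at h1
    exact h1
  exact tendsto_transport_comp_of_bounded_Ici hprof (ne_of_lt hγ2) (by norm_num : (-1 : ℝ) ≠ 0) hZc hder hy

/-- **ETERNAL LINGERERS CONVERGE TO ONE NODE when the stagnation set in the ball is COUNTABLE.**  Under the hypotheses of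
`tendsto_transport_flow_of_linger`, if `{z ∈ B̄(0, M) | W_U z = 0}` is countable then `Ψ_σ y → z` for a stagnation point
`z ∈ B̄(0, M)` (a cluster point exists by compactness; it is a node by (E1); convergence by
`NodalFiniteness.tendsto_of_transport_comp_tendsto_zero_of_countable` applied to the continuous field
`Ṽ x = (‖W_U x‖ + infDist(x, B̄_M))·e₀`, whose zero set is exactly the countable set of nodes in the ball).
[cite: ConstantinIgnatovaVicol2026Putative, §3.4.3 eq. (3.33), §3.5 proof of Thm 3.10] -/
theorem exists_tendsto_flow_of_linger_of_countable (hprof : IsSelfSimilarEulerProfile γ 0 U P) (hγ2 : γ < 1 / 2)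
    (hV : ContDiff ℝ 1 V) {K : ℝ} (hK : ∀ y, ‖fderiv ℝ V y‖ ≤ K) {M Rbig : ℝ} (hMR : M < Rbig)
    (hVU : ∀ w ∈ ball (0 : EuclideanSpace ℝ (Fin 3)) Rbig, V w = U w)
    (hcount : {z : EuclideanSpace ℝ (Fin 3) | z ∈ closedBall (0 : EuclideanSpace ℝ (Fin 3)) M ∧
      selfSimilarTransport γ 0 U z = 0}.Countable)
    {y : EuclideanSpace ℝ (Fin 3)}
    (hy : ∀ σ, 0 ≤ σ → ‖ODE.evolutionMap (fun _ : ℝ => selfSimilarTransport γ 0 V) 0 (-σ) y‖ ≤ M) :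
    ∃ z : EuclideanSpace ℝ (Fin 3), z ∈ closedBall (0 : EuclideanSpace ℝ (Fin 3)) M ∧
      selfSimilarTransport γ 0 U z = 0 ∧
      Tendsto (fun σ => ODE.evolutionMap (fun _ : ℝ => selfSimilarTransport γ 0 V) 0 (-σ) y) atTop (𝓝 z) := by
  set Z : ℝ → EuclideanSpace ℝ (Fin 3) :=
    fun σ => ODE.evolutionMap (fun _ : ℝ => selfSimilarTransport γ 0 V) 0 (-σ) y with hZ
  have hZc : Continuous Z := continuous_flow_neg_apply (γ := γ) hV hK y
  have hW0 := tendsto_transport_flow_of_linger hprof hγ2 hV hK hMR hVU hy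
  have hWc : Continuous (selfSimilarTransport γ 0 U) := by
    have e : selfSimilarTransport γ 0 U = fun y => γ • (y - 0) + U y := rfl
    rw [e]; exact ((continuous_id.sub continuous_const).const_smul γ).add hprof.contDiff_velocity.continuous
  have hM0 : 0 ≤ M := by
    have h0 := hy 0 le_rfl
    exact (norm_nonneg _).trans h0
  -- a cluster point in the compact ball
  have hKc := isCompact_closedBall (0 : EuclideanSpace ℝ (Fin 3)) M
  have hle : map Z atTop ≤ 𝓟 (closedBall (0 : EuclideanSpace ℝ (Fin 3)) M) := by
    rw [le_principal_iff, mem_map]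
    filter_upwards [eventually_ge_atTop (0 : ℝ)] with t ht
    exact mem_closedBall_zero_iff.2 (hy t ht)
  obtain ⟨z, hzK, hcl⟩ := hKc.exists_clusterPt hle
  -- the auxiliary field `Ṽ`
  set e₀ : EuclideanSpace ℝ (Fin 3) := EuclideanSpace.single 0 1 with he₀
  have he₀ne : e₀ ≠ 0 := by
    rw [he₀]; intro h0
    have := congrArg (fun v : EuclideanSpace ℝ (Fin 3) => v 0) h0
    simp at this
  set Vt : EuclideanSpace ℝ (Fin 3) → EuclideanSpace ℝ (Fin 3) := fun x =>
    (‖selfSimilarTransport γ 0 U x‖ + infDist x (closedBall (0 : EuclideanSpace ℝ (Fin 3)) M)) • e₀ with hVt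
  have hVtc : Continuous Vt :=
    ((hWc.norm).add (continuous_infDist_pt _)).smul continuous_const
  have hVt0 : {x | Vt x = 0} = {z : EuclideanSpace ℝ (Fin 3) | z ∈ closedBall (0 : EuclideanSpace ℝ (Fin 3)) M ∧
      selfSimilarTransport γ 0 U z = 0} := by
    ext x
    simp only [mem_setOf_eq, hVt, smul_eq_zero, he₀ne, or_false]
    have hne : (closedBall (0 : EuclideanSpace ℝ (Fin 3)) M).Nonempty := ⟨0, mem_closedBall_self hM0⟩
    constructor
    · intro hx
      have h1 : ‖selfSimilarTransport γ 0 U x‖ = 0 := by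
        linarith [norm_nonneg (selfSimilarTransport γ 0 U x), infDist_nonneg (x := x)
          (s := closedBall (0 : EuclideanSpace ℝ (Fin 3)) M)]
      have h2 : infDist x (closedBall (0 : EuclideanSpace ℝ (Fin 3)) M) = 0 := by
        linarith [norm_nonneg (selfSimilarTransport γ 0 U x)]
      exact ⟨(isClosed_closedBall.mem_iff_infDist_zero hne).2 h2, norm_eq_zero.1 h1⟩
    · rintro ⟨hxM, hWx⟩
      rw [hWx, norm_zero, (isClosed_closedBall.mem_iff_infDist_zero hne).1 hxM, add_zero]
  have hN : {x | Vt x = 0}.Countable := by rw [hVt0]; exact hcount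
  have hVtZ : Tendsto (fun t => Vt (Z t)) atTop (𝓝 0) := by
    have h1 : Tendsto (fun t => ‖selfSimilarTransport γ 0 U (Z t)‖ +
        infDist (Z t) (closedBall (0 : EuclideanSpace ℝ (Fin 3)) M)) atTop (𝓝 0) := by
      have ha := (tendsto_zero_iff_norm_tendsto_zero.1 hW0)
      have hb : Tendsto (fun t => infDist (Z t) (closedBall (0 : EuclideanSpace ℝ (Fin 3)) M)) atTop (𝓝 0) := by
        apply tendsto_const_nhds.congr'
        filter_upwards [eventually_ge_atTop (0 : ℝ)] with t ht
        exact (infDist_zero_of_mem (mem_closedBall_zero_iff.2 (hy t ht))).symm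
      simpa using ha.add hb
    have h2 := h1.smul_const e₀
    rw [zero_smul] at h2
    exact h2
  have hconv := NodalFiniteness.tendsto_of_transport_comp_tendsto_zero_of_countable hVtc hN hZc hy hVtZ hcl
  refine ⟨z, hzK, ?_, hconv⟩
  -- the limit is a node: `W_U(Z t) → W_U z` and `→ 0`
  exact tendsto_nhds_unique ((hWc.tendsto z).comp hconv) hW0

/-! ### (E2) vorticity stays alive; re-basing -/

/-- **(E2) VORTICAL LABELS STAY VORTICAL along lingering orbits.**  `V ∈ C¹`, `‖DV‖ ≤ K`, `V = U` on `ball 0 R_big ⊃ B̄_M`;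
if `curl U y ≠ 0` and `‖Ψ_σ y‖ ≤ M` on `[0, L]` then `curl U (Ψ_σ y) ≠ 0` for `σ ∈ [0, L]` ((T1′)
`norm_curl_sq_mul_exp_le_linger_orbit` with the constant stretching majorant `sup_{B̄_M}‖DU‖`).
[cite: ConstantinIgnatovaVicol2026Putative, §3.4.1 eq. (3.24)] -/
theorem curl_flow_ne_zero_of_linger (hprof : IsSelfSimilarEulerProfile γ 0 U P) (hV : ContDiff ℝ 1 V) {K : ℝ}
    (hK : ∀ y, ‖fderiv ℝ V y‖ ≤ K) {M Rbig : ℝ} (hMR : M < Rbig)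
    (hVU : ∀ w ∈ ball (0 : EuclideanSpace ℝ (Fin 3)) Rbig, V w = U w) {y : EuclideanSpace ℝ (Fin 3)}
    (hΩ : curl U y ≠ 0) {L : ℝ}
    (hy : ∀ σ ∈ Icc (0 : ℝ) L, ‖ODE.evolutionMap (fun _ : ℝ => selfSimilarTransport γ 0 V) 0 (-σ) y‖ ≤ M)
    {σ : ℝ} (hσ : σ ∈ Icc (0 : ℝ) L) :
    curl U (ODE.evolutionMap (fun _ : ℝ => selfSimilarTransport γ 0 V) 0 (-σ) y) ≠ 0 := by
  -- a constant stretching majorant on the ball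
  obtain ⟨S₀, hS₀⟩ := (isCompact_closedBall (0 : EuclideanSpace ℝ (Fin 3)) M).exists_bound_of_continuousOn
    ((hprof.contDiff_velocity.continuous_fderiv (by norm_num)).continuousOn)
  have hs : ∀ τ ∈ Icc (0 : ℝ) L, ∀ v,
      ⟪fderiv ℝ U (ODE.evolutionMap (fun _ : ℝ => selfSimilarTransport γ 0 V) 0 (-τ) y) v, v⟫ ≤ S₀ * ‖v‖ ^ 2 := by
    intro τ hτ v
    have hz := hS₀ _ (mem_closedBall_zero_iff.2 (hy τ hτ))
    calc ⟪fderiv ℝ U (ODE.evolutionMap (fun _ : ℝ => selfSimilarTransport γ 0 V) 0 (-τ) y) v, v⟫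
        ≤ ‖fderiv ℝ U (ODE.evolutionMap (fun _ : ℝ => selfSimilarTransport γ 0 V) 0 (-τ) y) v‖ * ‖v‖ :=
          real_inner_le_norm _ _
      _ ≤ (S₀ * ‖v‖) * ‖v‖ := by
          refine mul_le_mul_of_nonneg_right ?_ (norm_nonneg _)
          exact (ContinuousLinearMap.le_opNorm _ _).trans (mul_le_mul_of_nonneg_right hz (norm_nonneg _))
      _ = S₀ * ‖v‖ ^ 2 := by ring
  have hT1 := norm_curl_sq_mul_exp_le_linger_orbit hprof hV hK hMR hVU (s := fun _ => S₀) continuous_const hs hy σ hσ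
  intro h0
  rw [h0, norm_zero] at hT1
  have hpos : 0 < ‖curl U y‖ ^ 2 * Real.exp (2 * ∫ τ in (0:ℝ)..σ, (1 - S₀)) :=
    mul_pos (pow_pos (norm_pos_iff.2 hΩ) 2) (Real.exp_pos _)
  have : (0 : ℝ) ^ 2 = 0 := by norm_num
  rw [this] at hT1
  linarith

/-- **Re-basing a backward orbit** (group law): `Ψ_{τ + σ₀} y = Ψ_τ (Ψ_{σ₀} y)`. [folklore] -/
theorem flow_neg_add_of_linger (hV : ContDiff ℝ 1 V) {K : ℝ} (hK : ∀ y, ‖fderiv ℝ V y‖ ≤ K)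
    (y : EuclideanSpace ℝ (Fin 3)) (τ σ₀ : ℝ) :
    ODE.evolutionMap (fun _ : ℝ => selfSimilarTransport γ 0 V) 0 (-(τ + σ₀)) y =
      ODE.evolutionMap (fun _ : ℝ => selfSimilarTransport γ 0 V) 0 (-τ)
        (ODE.evolutionMap (fun _ : ℝ => selfSimilarTransport γ 0 V) 0 (-σ₀) y) := by
  rw [neg_add]
  exact C2.Kelvin.flow_add (γ := γ) hV hK (-τ) (-σ₀) y

end Summit.NavierStokesRegularity.NavierStokesRegularity.Theorems.PowerGaugeEulerLiouville.NeedleClock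

end
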